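import Mathlib
import Summits.AnomalousDissipation.AnomalousDissipation.Theorems.MarginalStabilityChainStretchedVortexRowsStubRowVorticityConstructionToolsMass

/-!
# Stub `stub_rowVorticityConstruction` (crux stmt-AnomalousDissipation-3009) — tools XII:
# `ΔΦ_ε^L` is an approximate identity on the period strip; `Φ_ε^L → Φ_L` under the integral

Helper file (supports stmt-AnomalousDissipation-3009). Fifth brick of the Poisson equation for the cylinder stream
integral. With `ΔΦ_ε^L(q) = (2π/L)² ε(cosh t + cos s)/D_ε² ≥ 0` of total mass `4π` on `S_L` (tools XI):

* `lapRowLogKerReg_le_off_ball` — off the ball `B(0, δ)` the bump is `O(ε)` uniformly: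
  `ΔΦ_ε^L(q) ≤ ε K(δ, L) e^{−2π|q₂|/L}`, whence `∫_{S_L ∖ B(0,δ)} ΔΦ_ε^L ≤ ε K'` (`setIntegral_lap_off_ball_le`);
* **`tendsto_integral_lap_mul`** — for a continuous bounded `h` on `ℝ × ℝ`,
  `∫_{S_L} ΔΦ_ε^L(q) h(q) dq → 4π h(0)` as `ε → 0⁺` (the `η/δ` argument: continuity of `h` at `0` on the ball,
  `O(ε)` mass off the ball);
* **`tendsto_integral_rowLogKerReg_mul`** — for a Gaussian-tailed continuous density `g`,
  `∫_{S_L} Φ_ε^L(q) g(p − q) dq → ∫_{S_L} Φ_L(q) g(p − q) dq` as `ε → 0⁺` (dominated convergence: off the origin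
  `|Φ_ε^L| ≤ 12 + 3|t| + 2/‖(s,t)‖` uniformly in `ε ≤ 1`, tools VIII, and `Φ_ε^L(q) → Φ_L(q)` for `q ≠ 0`).
Registered sub-goal proved here: `stub_rowVorticityConstruction_approxIdentity`. All `[folklore]`.
-/

set_option linter.dupNamespace false

noncomputable section

open Real Set Filter Topology MeasureTheory

namespace Summit.AnomalousDissipation.AnomalousDissipation.Theorems.MarginalStabilityChainStretchedVortexRows.RowBiotSavart

section Approx

variable {L ε : ℝ}

/-- OFF THE BALL the regularised Laplacian is `O(ε)`: for `q ∈ S_L`, `‖q‖ ≥ δ > 0`, `0 < ε`,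
`ΔΦ_ε^L(q) ≤ ε (2π/L)² (125 e²/(2πδ/L)⁴ + 16) e^{−2π|q₂|/L}`. [folklore] -/
theorem lapRowLogKerReg_le_off_ball (hL : 0 < L) (hε : 0 < ε) {δ : ℝ} (hδ : 0 < δ) {q : ℝ × ℝ}
    (hq : q ∈ Ioc (-(L / 2)) (L / 2) ×ˢ (univ : Set ℝ)) (hqδ : δ ≤ ‖q‖) :
    (2 * π / L) ^ 2 * (ε * (Real.cosh (2 * π * q.2 / L) + Real.cos (2 * π * q.1 / L)) /
        (Real.cosh (2 * π * q.2 / L) - Real.cos (2 * π * q.1 / L) + ε) ^ 2) ≤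
      ε * ((2 * π / L) ^ 2 * (125 * Real.exp 2 / (2 * π * δ / L) ^ 4 + 16)) * Real.exp (-(2 * π / L) * |q.2|) := by
  have hs := abs_normFst_le_pi hL hq
  have hqn : 0 < ‖q‖ := lt_of_lt_of_le hδ hqδ
  have hz : ((2 * π * q.1 / L, 2 * π * q.2 / L) : ℝ × ℝ) ≠ 0 := by
    intro h
    have := norm_normPt hL q
    rw [h, norm_zero] at this
    have : 0 < 2 * π / L * ‖q‖ := by positivity
    linarith
  have habs : |2 * π * q.2 / L| = 2 * π / L * |q.2| := by
    rw [abs_div, abs_mul, abs_of_pos hL, abs_of_pos (by positivity : (0:ℝ) < 2 * π)]; ring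
  have hc2 : 0 < (2 * π / L) ^ 2 := by positivity
  have he : 0 < Real.exp (-(2 * π / L) * |q.2|) := Real.exp_pos _
  suffices H : ε * (Real.cosh (2 * π * q.2 / L) + Real.cos (2 * π * q.1 / L)) /
      (Real.cosh (2 * π * q.2 / L) - Real.cos (2 * π * q.1 / L) + ε) ^ 2 ≤
      ε * (125 * Real.exp 2 / (2 * π * δ / L) ^ 4 + 16) * Real.exp (-(2 * π / L) * |q.2|) by
    calc (2 * π / L) ^ 2 * (ε * (Real.cosh (2 * π * q.2 / L) + Real.cos (2 * π * q.1 / L)) /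
        (Real.cosh (2 * π * q.2 / L) - Real.cos (2 * π * q.1 / L) + ε) ^ 2)
        ≤ (2 * π / L) ^ 2 * (ε * (125 * Real.exp 2 / (2 * π * δ / L) ^ 4 + 16) * Real.exp (-(2 * π / L) * |q.2|)) :=
          mul_le_mul_of_nonneg_left H hc2.le
      _ = _ := by ring
  rcases le_or_gt 2 |2 * π * q.2 / L| with ht | ht
  · have h := bumpReg_le_exp hε ht (2 * π * q.1 / L)
    rw [habs, show -(2 * π / L * |q.2|) = -(2 * π / L) * |q.2| by ring] at h
    refine h.trans ?_
    have hA : 0 ≤ 125 * Real.exp 2 / (2 * π * δ / L) ^ 4 := by positivity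
    have hsplit : ε * (125 * Real.exp 2 / (2 * π * δ / L) ^ 4 + 16) * Real.exp (-(2 * π / L) * |q.2|) =
        ε * (125 * Real.exp 2 / (2 * π * δ / L) ^ 4) * Real.exp (-(2 * π / L) * |q.2|) +
          ε * (16 * Real.exp (-(2 * π / L) * |q.2|)) := by ring
    rw [hsplit]
    linarith [mul_nonneg (mul_nonneg hε.le hA) he.le]
  · have h := bumpReg_le_of_norm hε (z := ((2 * π * q.1 / L, 2 * π * q.2 / L) : ℝ × ℝ)) hs hz
    simp only at h
    rw [norm_normPt hL] at h
    refine h.trans ?_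
    -- `cosh θ + 1 ≤ 5`, `‖z‖⁴ ≥ (2πδ/L)⁴`, `1 ≤ e² e^{−|θ|}`
    have hcosh : Real.cosh (2 * π * q.2 / L) + 1 ≤ 5 := by
      have h1 : Real.cosh (2 * π * q.2 / L) ≤ Real.cosh 2 := by
        rw [Real.cosh_le_cosh, abs_of_pos (by norm_num : (0:ℝ) < 2)]; exact ht.le
      have h2 : Real.cosh 2 ≤ 4 := by
        rw [Real.cosh_eq]
        have he2 : Real.exp 2 ≤ 2.7182818286 ^ 2 := by
          rw [show (2:ℝ) = 1 + 1 by norm_num, Real.exp_add, sq]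
          exact mul_le_mul Real.exp_one_lt_d9.le Real.exp_one_lt_d9.le (Real.exp_pos _).le (by norm_num)
        have h7 : (7:ℝ) ≤ Real.exp 2 := by
          rw [show (2:ℝ) = 1 + 1 by norm_num, Real.exp_add]; nlinarith [Real.exp_one_gt_d9]
        have he' : Real.exp (-2) ≤ 1 / 7 := by
          rw [Real.exp_neg, one_div]; exact inv_anti₀ (by norm_num) h7
        norm_num at he2 ⊢; linarith
      linarith
    have hzn : (2 * π * δ / L) ^ 4 ≤ (2 * π / L * ‖q‖) ^ 4 := by
      have : 2 * π * δ / L ≤ 2 * π / L * ‖q‖ := by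
        rw [show 2 * π * δ / L = 2 * π / L * δ by ring]
        exact mul_le_mul_of_nonneg_left hqδ (by positivity)
      exact pow_le_pow_left₀ (by positivity) this 4
    have hone : 1 ≤ Real.exp 2 * Real.exp (-(2 * π / L) * |q.2|) := by
      rw [← Real.exp_add]; refine Real.one_le_exp ?_
      rw [habs] at ht; nlinarith
    have hδ4 : 0 < (2 * π * δ / L) ^ 4 := by positivity
    calc ε * (25 * (Real.cosh (2 * π * q.2 / L) + 1) / (2 * π / L * ‖q‖) ^ 4)
        ≤ ε * (125 / (2 * π * δ / L) ^ 4) := by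
          refine mul_le_mul_of_nonneg_left ?_ hε.le
          rw [div_le_div_iff₀ (by positivity) hδ4]
          nlinarith [mul_le_mul hzn (by linarith : 25 * (Real.cosh (2 * π * q.2 / L) + 1) ≤ 125)
            (by positivity) (by positivity)]
      _ ≤ ε * (125 / (2 * π * δ / L) ^ 4) * (Real.exp 2 * Real.exp (-(2 * π / L) * |q.2|)) :=
          le_mul_of_one_le_right (by positivity) hone
      _ ≤ ε * (125 * Real.exp 2 / (2 * π * δ / L) ^ 4 + 16) * Real.exp (-(2 * π / L) * |q.2|) := by
          have h16 : 0 ≤ ε * 16 * Real.exp (-(2 * π / L) * |q.2|) := by positivity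
          have hsplit : ε * (125 * Real.exp 2 / (2 * π * δ / L) ^ 4 + 16) * Real.exp (-(2 * π / L) * |q.2|) =
              ε * (125 / (2 * π * δ / L) ^ 4) * (Real.exp 2 * Real.exp (-(2 * π / L) * |q.2|)) +
                ε * 16 * Real.exp (-(2 * π / L) * |q.2|) := by ring
          rw [hsplit]; linarith

/-- The regularised Laplacian is integrable on the strip. [folklore] -/
theorem integrable_lapRowLogKerReg (hL : 0 < L) (hε : 0 < ε) (hε1 : ε ≤ 1) :
    Integrable (fun q : ℝ × ℝ => (2 * π / L) ^ 2 * (ε * (Real.cosh (2 * π * q.2 / L) + Real.cos (2 * π * q.1 / L)) /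
        (Real.cosh (2 * π * q.2 / L) - Real.cos (2 * π * q.1 / L) + ε) ^ 2))
      ((volume : Measure (ℝ × ℝ)).restrict (Ioc (-(L / 2)) (L / 2) ×ˢ (univ : Set ℝ))) := by
  have habs : ∀ t : ℝ, |2 * π * t / L| = 2 * π / L * |t| := fun t => by
    rw [abs_div, abs_mul, abs_of_pos hL, abs_of_pos (by positivity : (0:ℝ) < 2 * π)]; ring
  refine integrable_strip_of_le_exp (by fun_prop)
    (A := (2 * π / L) ^ 2 * (((2 + 2 / ε) + (2 + 2 / ε) ^ 2 + 24) * Real.exp 2 + (1 / ε + (1 / ε) ^ 2 + 24) * Real.exp 2))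
    (D := 0) (c := 2 * π / L) le_rfl (by positivity) fun q _ => ?_
  have h1 := abs_kerRegU'_le_exp_all hε hε1 (2 * π * q.1 / L) (2 * π * q.2 / L)
  have h2 := abs_kerRegV'_le_exp_all hε hε1 (2 * π * q.1 / L) (2 * π * q.2 / L)
  rw [habs] at h1 h2
  rw [← lap_logKerReg hε, abs_mul, abs_of_pos (by positivity : (0:ℝ) < (2 * π / L) ^ 2), zero_div, add_zero,
    neg_mul]
  have h3 := abs_add_le ((Real.cosh (2 * π * q.2 / L) * (Real.cosh (2 * π * q.2 / L) - Real.cos (2 * π * q.1 / L) + ε) -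
      Real.sinh (2 * π * q.2 / L) ^ 2) / (Real.cosh (2 * π * q.2 / L) - Real.cos (2 * π * q.1 / L) + ε) ^ 2)
    ((Real.cos (2 * π * q.1 / L) * (Real.cosh (2 * π * q.2 / L) - Real.cos (2 * π * q.1 / L) + ε) -
      Real.sin (2 * π * q.1 / L) ^ 2) / (Real.cosh (2 * π * q.2 / L) - Real.cos (2 * π * q.1 / L) + ε) ^ 2)
  nlinarith [h3, sq_nonneg (2 * π / L), Real.exp_pos (-(2 * π / L * |q.2|))]

/-- **Small mass off the ball**: `∫_{S_L ∖ B(0,δ)} ΔΦ_ε^L ≤ ε · K(δ,L) · ∫_{S_L} e^{−2π|q₂|/L}`. [folklore] -/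
theorem setIntegral_lap_off_ball_le (hL : 0 < L) (hε : 0 < ε) (hε1 : ε ≤ 1) {δ : ℝ} (hδ : 0 < δ) :
    ∫ q in (Ioc (-(L / 2)) (L / 2) ×ˢ (univ : Set ℝ)) \ Metric.ball (0 : ℝ × ℝ) δ,
        (2 * π / L) ^ 2 * (ε * (Real.cosh (2 * π * q.2 / L) + Real.cos (2 * π * q.1 / L)) /
          (Real.cosh (2 * π * q.2 / L) - Real.cos (2 * π * q.1 / L) + ε) ^ 2) ≤
      ε * (((2 * π / L) ^ 2 * (125 * Real.exp 2 / (2 * π * δ / L) ^ 4 + 16)) *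
        ∫ q in Ioc (-(L / 2)) (L / 2) ×ˢ (univ : Set ℝ), Real.exp (-(2 * π / L) * |q.2|)) := by
  set S : Set (ℝ × ℝ) := Ioc (-(L / 2)) (L / 2) ×ˢ (univ : Set ℝ)
  set K : ℝ := (2 * π / L) ^ 2 * (125 * Real.exp 2 / (2 * π * δ / L) ^ 4 + 16)
  have hSm : MeasurableSet S := measurableSet_Ioc.prod MeasurableSet.univ
  have iE : Integrable (fun q : ℝ × ℝ => Real.exp (-(2 * π / L) * |q.2|)) (volume.restrict S) := by
    have hc : 0 < 2 * π / L := by positivity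
    have h0 := MarginalStabilityChainBurgersLayerLowRe.integrable_kernel hc 0
    have h1 : Integrable (fun t : ℝ => Real.exp (-(2 * π / L) * |t|)) :=
      h0.congr (Eventually.of_forall fun t => by simp only [zero_sub, abs_neg]; ring_nf)
    exact integrable_strip_of_snd L h1
  have ilap := integrable_lapRowLogKerReg hL hε hε1
  calc ∫ q in S \ Metric.ball (0 : ℝ × ℝ) δ, (2 * π / L) ^ 2 * (ε * (Real.cosh (2 * π * q.2 / L) +
          Real.cos (2 * π * q.1 / L)) / (Real.cosh (2 * π * q.2 / L) - Real.cos (2 * π * q.1 / L) + ε) ^ 2)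
      ≤ ∫ q in S \ Metric.ball (0 : ℝ × ℝ) δ, ε * K * Real.exp (-(2 * π / L) * |q.2|) := by
        refine setIntegral_mono_on (IntegrableOn.mono_set ilap (fun _ hq => hq.1))
          (IntegrableOn.mono_set (iE.const_mul (ε * K)) (fun _ hq => hq.1)) (hSm.diff measurableSet_ball) fun q hq => ?_
        have hqδ : δ ≤ ‖q‖ := by
          have := hq.2; rw [Metric.mem_ball, dist_zero_right, not_lt] at this; exact this
        exact lapRowLogKerReg_le_off_ball hL hε hδ hq.1 hqδ
    _ ≤ ∫ q in S, ε * K * Real.exp (-(2 * π / L) * |q.2|) :=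
        setIntegral_mono_set (iE.const_mul (ε * K)) (Eventually.of_forall fun q => by positivity)
          (Eventually.of_forall (fun _ hq => hq.1))
    _ = ε * (K * ∫ q in S, Real.exp (-(2 * π / L) * |q.2|)) := by rw [integral_const_mul]; ring

/-- **`ΔΦ_ε^L` is an approximate identity on the strip**: for `h` continuous and bounded on `ℝ × ℝ`,
`∫_{S_L} ΔΦ_ε^L(q) h(q) dq → 4π h(0)` as `ε → 0⁺`. [folklore] -/
theorem tendsto_integral_lap_mul (hL : 0 < L) {h : ℝ × ℝ → ℝ} (hh : Continuous h) {M : ℝ} (hM : ∀ q, |h q| ≤ M) :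
    Tendsto (fun ε => ∫ q in Ioc (-(L / 2)) (L / 2) ×ˢ (univ : Set ℝ),
      (2 * π / L) ^ 2 * (ε * (Real.cosh (2 * π * q.2 / L) + Real.cos (2 * π * q.1 / L)) /
        (Real.cosh (2 * π * q.2 / L) - Real.cos (2 * π * q.1 / L) + ε) ^ 2) * h q) (𝓝[>] 0) (𝓝 (4 * π * h 0)) := by
  set S : Set (ℝ × ℝ) := Ioc (-(L / 2)) (L / 2) ×ˢ (univ : Set ℝ)
  have hSm : MeasurableSet S := measurableSet_Ioc.prod MeasurableSet.univ
  have hM0 : 0 ≤ M := (abs_nonneg _).trans (hM 0)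
  set I : ℝ := ∫ q in S, Real.exp (-(2 * π / L) * |q.2|)
  have hI : 0 ≤ I := integral_nonneg fun q => (Real.exp_pos _).le
  rw [Metric.tendsto_nhdsWithin_nhds]
  intro η hη
  -- continuity of `h` at the origin
  obtain ⟨δ, hδ, hcont⟩ := Metric.continuousAt_iff.1 hh.continuousAt (η / (8 * π + 1)) (by positivity)
  set K : ℝ := (2 * π / L) ^ 2 * (125 * Real.exp 2 / (2 * π * δ / L) ^ 4 + 16)
  have hK : 0 ≤ K := by positivity
  refine ⟨min 1 (η / (2 * ((2 * M + 1) * K * I) + 1)), by positivity, fun ε hε0 hεd => ?_⟩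
  simp only [mem_Ioi] at hε0
  rw [dist_zero_right, Real.norm_eq_abs, abs_of_pos hε0, lt_min_iff] at hεd
  have hε1 : ε ≤ 1 := hεd.1.le
  have ilap := integrable_lapRowLogKerReg hL hε0 hε1
  set ρ : ℝ × ℝ → ℝ := fun q => (2 * π / L) ^ 2 * (ε * (Real.cosh (2 * π * q.2 / L) + Real.cos (2 * π * q.1 / L)) /
    (Real.cosh (2 * π * q.2 / L) - Real.cos (2 * π * q.1 / L) + ε) ^ 2) with hρ
  have hρ0 : ∀ q, 0 ≤ ρ q := fun q => mul_nonneg (by positivity) (bumpReg_nonneg hε0 _ _)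
  have hmass : ∫ q in S, ρ q = 4 * π := integral_lapRowLogKerReg hL hε0 hε1
  have htail := setIntegral_lap_off_ball_le hL hε0 hε1 hδ
  -- `∫ ρ h − 4π h(0) = ∫ ρ (h − h 0)`
  have iρh : Integrable (fun q => ρ q * h q) (volume.restrict S) := by
    refine (ilap.norm.mul_const M).mono' (ilap.aestronglyMeasurable.mul hh.aestronglyMeasurable)
      (Eventually.of_forall fun q => ?_)
    rw [norm_mul]; exact mul_le_mul_of_nonneg_left (by rw [Real.norm_eq_abs]; exact hM q) (norm_nonneg _)
  have hdiff : (∫ q in S, ρ q * h q) - 4 * π * h 0 = ∫ q in S, ρ q * (h q - h 0) := by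
    rw [← hmass, ← integral_mul_const, ← integral_sub iρh (ilap.mul_const _)]
    refine integral_congr_ae (Eventually.of_forall fun q => ?_); ring
  rw [Real.dist_eq, hdiff]
  -- pointwise: `ρ |h − h0| ≤ ρ · η' + 2M ρ 1_{∖ ball}`
  have hpt : ∀ q ∈ S, |ρ q * (h q - h 0)| ≤
      η / (8 * π + 1) * ρ q + 2 * M * (S \ Metric.ball (0 : ℝ × ℝ) δ).indicator ρ q := by
    intro q hq
    rw [abs_mul, abs_of_nonneg (hρ0 q)]
    by_cases hqδ : q ∈ Metric.ball (0 : ℝ × ℝ) δ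
    · have h1 : |h q - h 0| ≤ η / (8 * π + 1) := by
        have := hcont (Metric.mem_ball.1 hqδ)
        rw [Real.dist_eq] at this; exact this.le
      have h2 : 0 ≤ 2 * M * (S \ Metric.ball (0 : ℝ × ℝ) δ).indicator ρ q :=
        mul_nonneg (by positivity) (indicator_nonneg (fun q _ => hρ0 q) q)
      nlinarith [hρ0 q]
    · rw [indicator_of_mem (show q ∈ S \ Metric.ball (0 : ℝ × ℝ) δ from ⟨hq, hqδ⟩)]
      have h1 : |h q - h 0| ≤ 2 * M := by
        have := abs_sub (h q) (h 0); linarith [hM q, hM 0]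
      have h3 : 0 ≤ η / (8 * π + 1) * ρ q := mul_nonneg (by positivity) (hρ0 q)
      nlinarith [hρ0 q]
  have iind : Integrable ((S \ Metric.ball (0 : ℝ × ℝ) δ).indicator ρ) (volume.restrict S) :=
    (ilap.indicator (hSm.diff measurableSet_ball))
  have isub : Integrable (fun q => ρ q * (h q - h 0)) (volume.restrict S) :=
    (iρh.sub (ilap.mul_const (h 0))).congr (Eventually.of_forall fun q => by simp only [Pi.sub_apply]; ring)
  have hI1 : (∫ q in S, η / (8 * π + 1) * ρ q) = η / (8 * π + 1) * (4 * π) := by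
    rw [integral_const_mul (μ := volume.restrict S) (η / (8 * π + 1)) ρ, hmass]
  have hI2 : (∫ q in S, 2 * M * (S \ Metric.ball (0 : ℝ × ℝ) δ).indicator ρ q) =
      2 * M * ∫ q in S \ Metric.ball (0 : ℝ × ℝ) δ, ρ q := by
    rw [integral_const_mul (μ := volume.restrict S) (2 * M) ((S \ Metric.ball (0 : ℝ × ℝ) δ).indicator ρ),
      integral_indicator (hSm.diff measurableSet_ball), Measure.restrict_restrict (hSm.diff measurableSet_ball),
      inter_eq_left.2 (fun _ hq => hq.1)]
  calc |∫ q in S, ρ q * (h q - h 0)| ≤ ∫ q in S, |ρ q * (h q - h 0)| := abs_integral_le_integral_abs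
    _ ≤ ∫ q in S, (η / (8 * π + 1) * ρ q + 2 * M * (S \ Metric.ball (0 : ℝ × ℝ) δ).indicator ρ q) :=
        setIntegral_mono_on isub.abs ((ilap.const_mul _).add (iind.const_mul _)) hSm hpt
    _ = η / (8 * π + 1) * (4 * π) + 2 * M * ∫ q in S \ Metric.ball (0 : ℝ × ℝ) δ, ρ q := by
        rw [integral_add (ilap.const_mul _) (iind.const_mul _), hI1, hI2]
    _ ≤ η / (8 * π + 1) * (4 * π) + 2 * M * (ε * (K * I)) := by
        have := mul_le_mul_of_nonneg_left htail (by positivity : (0:ℝ) ≤ 2 * M)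
        linarith
    _ < η := by
        have h1 : η / (8 * π + 1) * (4 * π) < η / 2 := by
          rw [div_mul_eq_mul_div, div_lt_div_iff₀ (by positivity) (by norm_num)]
          nlinarith [Real.pi_pos]
        have h2 : 2 * M * (ε * (K * I)) ≤ η / 2 := by
          have hε2 := hεd.2
          have hpos : 0 < 2 * ((2 * M + 1) * K * I) + 1 := by positivity
          have h3 : ε * (2 * ((2 * M + 1) * K * I) + 1) ≤ η := by
            rw [lt_div_iff₀ hpos] at hε2; exact hε2.le
          nlinarith [mul_nonneg hK hI, mul_nonneg hM0 (mul_nonneg hK hI)]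
        linarith

/-! ### `Φ_ε^L → Φ_L` under the integral -/

/-- **The regularised stream integrals converge**: for a continuous plane field `w` with `|w(a,b)| ≤ C e^{−a b²}`,
`∫_{S_L} Φ_ε^L(q) w(x − q₁, y − q₂) dq → ∫_{S_L} Φ_L(q) w(x − q₁, y − q₂) dq` as `ε → 0⁺`. [folklore] -/
theorem tendsto_integral_rowLogKerReg_mul (hL : 0 < L) {w : ℝ → ℝ → ℝ} (hw : Continuous fun p : ℝ × ℝ => w p.1 p.2)
    {C a : ℝ} (ha : 0 < a) (hb : ∀ a' b, |w a' b| ≤ C * Real.exp (-a * b ^ 2)) (x y : ℝ) :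
    Tendsto (fun ε => ∫ q in Ioc (-(L / 2)) (L / 2) ×ˢ (univ : Set ℝ),
      Real.log (Real.cosh (2 * π * q.2 / L) - Real.cos (2 * π * q.1 / L) + ε) * w (x - q.1) (y - q.2)) (𝓝[>] 0)
      (𝓝 (∫ q in Ioc (-(L / 2)) (L / 2) ×ˢ (univ : Set ℝ),
        Real.log (Real.cosh (2 * π * q.2 / L) - Real.cos (2 * π * q.1 / L)) * w (x - q.1) (y - q.2))) := by
  set S : Set (ℝ × ℝ) := Ioc (-(L / 2)) (L / 2) ×ˢ (univ : Set ℝ)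
  have hSm : MeasurableSet S := measurableSet_Ioc.prod MeasurableSet.univ
  have hC : 0 ≤ C := by have := (abs_nonneg _).trans (hb 0 0); simpa using this
  have hwc : Continuous fun q : ℝ × ℝ => w (x - q.1) (y - q.2) :=
    hw.comp ((continuous_const.sub continuous_fst).prodMk (continuous_const.sub continuous_snd))
  -- the dominating function
  set f : ℝ × ℝ → ℝ := fun q => 12 + 6 * π / L * |q.2| + L / π / ‖q‖
  have hf0 : ∀ q, 0 ≤ f q := fun q => by positivity
  have mf : Measurable f := by fun_prop
  have hfi : Integrable (fun q => ‖f q‖ * Real.exp (-a * (y - q.2) ^ 2)) (volume.restrict S) :=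
    gaussTestable_of_le mf (A := 12) (B := 6 * π / L) (D := L / π) (by positivity) (by positivity)
      (fun q _ => by rw [abs_of_nonneg (hf0 q)]) a ha y
  refine tendsto_integral_filter_of_dominated_convergence (fun q => ‖f q‖ * Real.exp (-a * (y - q.2) ^ 2) * C)
    (Eventually.of_forall fun ε => ?_) ?_ (hfi.mul_const C) ?_
  · exact ((by fun_prop : Measurable fun q : ℝ × ℝ =>
      Real.log (Real.cosh (2 * π * q.2 / L) - Real.cos (2 * π * q.1 / L) + ε)).aestronglyMeasurable.mul
      hwc.aestronglyMeasurable)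
  · have hae : ∀ᵐ q ∂(volume : Measure (ℝ × ℝ)), q ≠ 0 := by simp [ae_iff]
    filter_upwards [Ioo_mem_nhdsGT (zero_lt_one' ℝ)] with ε hε
    rw [ae_restrict_iff' hSm]
    filter_upwards [hae] with q hq0 hq
    have hz : ((2 * π * q.1 / L, 2 * π * q.2 / L) : ℝ × ℝ) ≠ 0 := by
      intro h
      have := norm_normPt hL q
      rw [h, norm_zero] at this
      have : 0 < 2 * π / L * ‖q‖ := mul_pos (by positivity) (norm_pos_iff.2 hq0)
      linarith
    have h1 := abs_logKerReg_le hε.1 hε.2.le (z := ((2 * π * q.1 / L, 2 * π * q.2 / L) : ℝ × ℝ))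
      (abs_normFst_le_pi hL hq) hz
    rw [norm_normPt hL] at h1
    have habs : |2 * π * q.2 / L| = 2 * π / L * |q.2| := by
      rw [abs_div, abs_mul, abs_of_pos hL, abs_of_pos (by positivity : (0:ℝ) < 2 * π)]; ring
    simp only [habs] at h1
    have hf1 : |Real.log (Real.cosh (2 * π * q.2 / L) - Real.cos (2 * π * q.1 / L) + ε)| ≤ f q := by
      refine h1.trans (le_of_eq ?_)
      simp only [f]; field_simp; ring
    rw [norm_mul, Real.norm_eq_abs, Real.norm_eq_abs, Real.norm_eq_abs, abs_of_nonneg (hf0 q)]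
    calc _ ≤ f q * (C * Real.exp (-a * (y - q.2) ^ 2)) := mul_le_mul hf1 (hb _ _) (abs_nonneg _) (hf0 q)
      _ = f q * Real.exp (-a * (y - q.2) ^ 2) * C := by ring
  · rw [ae_restrict_iff' hSm]
    have hae : ∀ᵐ q ∂(volume : Measure (ℝ × ℝ)), q ≠ 0 := by simp [ae_iff]
    filter_upwards [hae] with q hq0 hq
    refine Tendsto.mul_const _ ?_
    have hz : ((2 * π * q.1 / L, 2 * π * q.2 / L) : ℝ × ℝ) ≠ 0 := by
      intro h
      have := norm_normPt hL q
      rw [h, norm_zero] at this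
      have : 0 < 2 * π / L * ‖q‖ := mul_pos (by positivity) (norm_pos_iff.2 hq0)
      linarith
    have hD := den_pos (z := ((2 * π * q.1 / L, 2 * π * q.2 / L) : ℝ × ℝ)) (abs_normFst_le_pi hL hq) hz
    simp only at hD
    have h1 : Tendsto (fun ε : ℝ => Real.cosh (2 * π * q.2 / L) - Real.cos (2 * π * q.1 / L) + ε) (𝓝[>] 0)
        (𝓝 (Real.cosh (2 * π * q.2 / L) - Real.cos (2 * π * q.1 / L))) := by
      have := ((tendsto_const_nhds (x := Real.cosh (2 * π * q.2 / L) - Real.cos (2 * π * q.1 / L))).add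
        (tendsto_id (α := ℝ) (x := 𝓝 0)))
      rw [add_zero] at this
      exact this.mono_left nhdsWithin_le_nhds
    exact (Real.continuousAt_log hD.ne').tendsto.comp h1

end Approx

end RowBiotSavart

open RowBiotSavart in
/-- **`ΔΦ_ε^L` is an approximate identity on the period strip** (registered on stmt-AnomalousDissipation-3009 as the
helper stub `stub_rowVorticityConstruction_approxIdentity` of `stub_rowVorticityConstruction`): for `L > 0` and a
continuous bounded `h` on `ℝ × ℝ`, `∫_{S_L} ΔΦ_ε^L(q) h(q) dq → 4π h(0)` as `ε → 0⁺`
(`RowBiotSavart.tendsto_integral_lap_mul`). [folklore] -/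
theorem stub_rowVorticityConstruction_approxIdentity :
    ∀ (L : ℝ) (h : ℝ × ℝ → ℝ) (M : ℝ), 0 < L → Continuous h → (∀ q, |h q| ≤ M) →
      Filter.Tendsto (fun ε => ∫ q in Set.Ioc (-(L / 2)) (L / 2) ×ˢ (Set.univ : Set ℝ),
        (2 * Real.pi / L) ^ 2 * (ε * (Real.cosh (2 * Real.pi * q.2 / L) + Real.cos (2 * Real.pi * q.1 / L)) /
          (Real.cosh (2 * Real.pi * q.2 / L) - Real.cos (2 * Real.pi * q.1 / L) + ε) ^ 2) * h q)
        (nhdsWithin 0 (Set.Ioi 0)) (nhds (4 * Real.pi * h 0)) :=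
  fun _ _ _ hL hh hM => tendsto_integral_lap_mul hL hh hM

end Summit.AnomalousDissipation.AnomalousDissipation.Theorems.MarginalStabilityChainStretchedVortexRows

end
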